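/-
Copyright (c) 2026 the pub-hodgecm-mathlib formalisation cell (harness21).  Prover seat hodgecm-mathlib-R90-C14-p02 (g0) (R90-TF free hand routed by CHAIR VALVE W4 to
L1; LEAD F0P6-plan (g14) BATCH #86 (3) 2026-09-04T22:33:10Z «(K1a-4) `K2LiuRankOneSingularEulerContinued` (M), hypothesis-first on (K1a-2)(K1a-3) local letters»), Track B
«K2-LIT», #184♮ = hLiu418 = stmt-HodgeConjecture-24832; line lead K2E5-p16 (g8), census `K2/K2E5-p16/g8/CENSUS-K1a-GK.K2E5-p16-g8.md` 7c6ffe7718f089b5 §3 (K1a-4).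
CURRENCY-LIGHT CORE (SIG posted 2026-09-04T22:37:39Z on the K2 bus): the pole-clearing assembly of the KIND 1 a♮ Euler tail, G1-agnostic.
-/
import Summits.HodgeConjecture.HodgeConjecture.Theorems.K2LiuKindOneSingularScalarGL1   -- (this seat, FILE 1) `exists_differentiableOn_sub_half_mul_scalarK1{,_cm}`; brings ★ O41.6
import Mathlib.Analysis.Calculus.Deriv.Mul
import HarnessLib

/-!
# Crux `HLiu418`, road `K2_Liu`, socket #41 KIND 1 a♮ — (K1a-4) CORE `K2LiuRankOneSingularEulerContinued`: from the EULER TAIL IDENTITY of the singular rank-one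
# big-cell term to the pole-cleared continued term `Eac` with `hEad` (holomorphy on `Re s > 0`) and `hEac` (pin on `Re s > 1`)

Cell `hodgecm-mathlib`, crux item hLiu418 = `stmt-HodgeConjecture-24832`, route `HCCMUnconditional`; squad K2 ∕ K2Liu, LEAD F0P6-plan (g14), line lead K2E5-p16 (g8).
THEOREMS ONLY (no `def`, no instance, no notation, no named-fact hypothesis, no `sorry`, default heartbeats); lane `--supports stmt-HodgeConjecture-24832 --as helper`
(count-neutral).  CLOSES NO SOCKET: the tail identity `htail` is the letter supplied by ★ G1 `K2LiuWhittakerDeltaEulerProduct.whittakerDelta_eq_mul_tprod_euler` at the corner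
index `S♭` ∘ (K1a-2) `K2LiuRankOneSingularLocalValue` pointwise off `T` ∘ ★ `K2LiuBigCellTailScalar.tprod_eq_scalar_of_forall_eq`-pattern (census §3), and the head
holomorphy `hHT` is (K1a-3) `K2LiuRankOneSingularLocalRegularity` ∕ `…ArchRegularity`; both are in flight and enter here BY VALUE as visible binders.

THE MATHEMATICS (K2E5-p16's census §1∕§3; [Tan1999 §3, §4 Prop. 4.8]; [KudlaRallis1994 §2]).  On `Re s > 1` the ψ_{S♭}-Whittaker integral of the Siegel section factors as
  `W(s)(x) = HEAD_T(s, x) · [ζ_F^T(2s) ∕ (ζ_F^T(2s+1)·L^T(2s+2, ε))] · ∏_{v ∈ D} P°_v(σ; s − ½)`,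
`HEAD_T` holomorphic on `Re s > 0` (bad + archimedean places, (K1a-3)), `D = {v ∉ T : ord_v σ ≥ 1}` FINITE, `P°_v` polynomials in `q_v^{−s}` (entire).  FILE 1 gives `G` holomorphic on
`Re s > 0` with `(s − ½)·scalar = G(s)`; hence **`Eac(s, x) := HEAD_T(s, x) · G(s) · ∏_{v∈D} P°_v(s)`** is holomorphic on `Re s > 0` in `s` for every `x` and equals `(s − ½)·W(s)(x)` on
`Re s > 1` — NO identity theorem is used (the pin's domain IS the tail's domain), exactly as the census prescribes; `ρa = (s − ½)⁻¹`, `G := 1` in ★ p862409's letters of record.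
* §1 **`exists_Eac_of_tail_letters`** — fully generic: any scalar `sc` with a pole-cleared continuation `(s − ½)·sc = G` on `Re s > ½`, any head, any finite family of entire factors.
* §2 **`exists_Eac_of_tail_scalarK1_cm`** — §1 with `sc :=` the K1 scalar of record `ζ_{L⁺}^T(2s) ∕ (ζ_{L⁺}^T(2s+1)·L^T(2s+2, ε_{L∕L⁺}))` and `G` from FILE 1 `…scalarK1_cm`
  (the census's `hasProd_localScalarK1` ∕ `exists_differentiableOn_sub_half_mul_scalarK1_cm` siblings consumed BY NAME).
`haG` (weighted growth) and `hpres` (Euler presentation at `s = ½`) are NOT here: they ride on the local growth ∕ value letters of (K1a-2)(K1a-3) and the ★ S5-F2 currency.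
HONEST LABEL.  Count-neutral helper; it retires nothing by itself: `HC_CM` is proved only modulo the 7 printed citations (2 remaining named inputs: hLiu418 =
`stmt-HodgeConjecture-24832`, h413 = `stmt-HodgeConjecture-24833`) until rung 0 closes.

## References
* [Tan1999] V. Tan, *Poles of Siegel Eisenstein series on U(n,n)*, Canad. J. Math. 51 (1999) 164–175: §3, §4 Prop. 4.8.
* [KudlaRallis1994] S. Kudla, S. Rallis, *A regularized Siegel–Weil formula: the first term identity*, Ann. of Math. 140 (1994): §2.
* [MoeglinWaldspurger1995] C. Mœglin, J.-L. Waldspurger, *Spectral Decomposition and Eisenstein Series* (1995): II.1.7, IV.1.8–1.11.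
-/

set_option autoImplicit false
set_option linter.dupNamespace false -- the mandated namespace repeats `HodgeConjecture.HodgeConjecture`

noncomputable section

open scoped NNReal
open Filter Topology Complex NumberField IsDedekindDomain
open Literature.NumberTheory.Automorphic Literature.NumberTheory.LFunctions Literature.NumberTheory.GaloisRepresentations
open Summit.HodgeConjecture.HodgeConjecture.Cruxes.HLiu418.K2LiuKindOneSingularScalarGL1

namespace Summit.HodgeConjecture.HodgeConjecture.Cruxes.HLiu418.K2LiuRankOneSingularEulerContinued

/-! ## §1 Generic: Euler tail identity + pole-cleared scalar ⟹ the continued term `Eac` -/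

/-- **`Eac` FROM THE TAIL LETTERS (generic).**  Let `W, HT : ℂ → X → ℂ` (the term and its head), `sc, G : ℂ → ℂ` (a scalar and its pole-cleared continuation:
`(s − ½)·sc(s) = G(s)` for `Re s > ½`, `G` holomorphic on `Re s > 0`), `D` a finite index set with factors `P v` holomorphic on `Re s > 0`, `HT(·, x)` holomorphic on `Re s > 0`
for every `x`, and the TAIL IDENTITY `W(s)(x) = HT(s, x)·sc(s)·∏_{v∈D} P v s` on `Re s > 1`.  Then `Eac(s, x) := HT(s, x)·G(s)·∏_{v∈D} P v s` is holomorphic on `Re s > 0` in `s`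
for every `x` (`hEad`) and `(s − ½)·W(s)(x) = Eac(s, x)` on `Re s > 1` (`hEac`). [cite: Tan1999, §4 Prop. 4.8] [cite: KudlaRallis1994, §2] -/
theorem exists_Eac_of_tail_letters {X : Type*} {ι : Type*} (W HT : ℂ → X → ℂ) (sc G : ℂ → ℂ) (D : Finset ι) (P : ι → ℂ → ℂ)
    (hHT : ∀ x, DifferentiableOn ℂ (fun s => HT s x) {s : ℂ | 0 < s.re})
    (hP : ∀ v ∈ D, DifferentiableOn ℂ (P v) {s : ℂ | 0 < s.re})
    (hG : DifferentiableOn ℂ G {s : ℂ | 0 < s.re}) (hsc : ∀ s : ℂ, 1 / 2 < s.re → (s - 1 / 2) * sc s = G s)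
    (htail : ∀ s : ℂ, 1 < s.re → ∀ x, W s x = HT s x * sc s * ∏ v ∈ D, P v s) :
    ∃ Eac : ℂ → X → ℂ, (∀ x, DifferentiableOn ℂ (fun s => Eac s x) {s : ℂ | 0 < s.re}) ∧
      ∀ s : ℂ, 1 < s.re → ∀ x, (s - 1 / 2) * W s x = Eac s x := by
  refine ⟨fun s x => HT s x * G s * ∏ v ∈ D, P v s, fun x => ((hHT x).mul hG).mul (DifferentiableOn.fun_finsetProd hP), fun s hs x => ?_⟩
  have hs' : 1 / 2 < s.re := by linarith
  show (s - 1 / 2) * W s x = HT s x * G s * ∏ v ∈ D, P v s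
  rw [htail s hs x, ← hsc s hs']
  ring

/-- **Growth bookkeeping for `Eac` (generic)**: a pointwise bound `‖HT s x‖ ≤ C x·B s` propagates to `‖Eac s x‖ ≤ (C x·‖G s‖·∏‖P v s‖)·B s` — the shape in which the
weighted-growth letter `haG` is later discharged from (K1a-3)'s local growth letters (the `x`-dependence of `C` is the height weight). [folklore] -/
theorem norm_Eac_le {X : Type*} {ι : Type*} (HT : ℂ → X → ℂ) (G : ℂ → ℂ) (D : Finset ι) (P : ι → ℂ → ℂ)
    (C : X → ℝ) (B : ℂ → ℝ) (hB : ∀ s x, ‖HT s x‖ ≤ C x * B s) (s : ℂ) (x : X) :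
    ‖HT s x * G s * ∏ v ∈ D, P v s‖ ≤ (C x * ‖G s‖ * ∏ v ∈ D, ‖P v s‖) * B s := by
  rw [norm_mul, norm_mul, norm_prod]
  have h1 := hB s x
  have hG0 : 0 ≤ ‖G s‖ := norm_nonneg _
  have hP0 : 0 ≤ ∏ v ∈ D, ‖P v s‖ := Finset.prod_nonneg fun v _ => norm_nonneg _
  calc ‖HT s x‖ * ‖G s‖ * ∏ v ∈ D, ‖P v s‖ ≤ C x * B s * ‖G s‖ * ∏ v ∈ D, ‖P v s‖ := by gcongr
    _ = (C x * ‖G s‖ * ∏ v ∈ D, ‖P v s‖) * B s := by ring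

/-! ## §2 The K1 scalar of record: `sc := ζ_{L⁺}^T(2s) ∕ (ζ_{L⁺}^T(2s+1)·L^T(2s+2, ε_{L∕L⁺}))`, `G` from FILE 1 -/

section CM

variable (L : Type) [Field L] [NumberField L] [IsCMField L]

/-- **(K1a-4) CORE AT THE K2_Liu FRAME — `Eac` from the Euler tail identity of the singular rank-one term.**  For a finite set `T` of finite places of `L⁺`, a head `HT`
holomorphic on `Re s > 0` in `s` (the bad∕archimedean factor of (K1a-3)), a finite family `P v` of factors holomorphic on `Re s > 0` (the `P°_v(σ; s − ½)`, `v ∈ D`), and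
the TAIL IDENTITY on `Re s > 1`
  `W(s)(x) = HT(s, x) · [ζ_{L⁺}^T(2s) ∕ (ζ_{L⁺}^T(2s+1)·L^T(2s+2, ε_{L∕L⁺}))] · ∏_{v∈D} P v s`
(★ G1 at `S♭` ∘ (K1a-2) ∘ FILE 1 `hasProd_localScalarK1_cm`), there is `Eac : ℂ → X → ℂ`, holomorphic on `Re s > 0` in `s` for every `x`, with `(s − ½)·W(s)(x) = Eac(s, x)` on
`Re s > 1` — FILE 1 `exists_differentiableOn_sub_half_mul_scalarK1_cm` ∘ §1. [cite: Tan1999, §3; §4 Prop. 4.8] [cite: KudlaRallis1994, §2] -/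
theorem exists_Eac_of_tail_scalarK1_cm {X : Type*} {ι : Type*} {T : Set (HeightOneSpectrum (𝓞 ↥(maximalRealSubfield L)))} (hT : T.Finite)
    (W HT : ℂ → X → ℂ) (D : Finset ι) (P : ι → ℂ → ℂ)
    (hHT : ∀ x, DifferentiableOn ℂ (fun s => HT s x) {s : ℂ | 0 < s.re})
    (hP : ∀ v ∈ D, DifferentiableOn ℂ (P v) {s : ℂ | 0 < s.re})
    (htail : ∀ s : ℂ, 1 < s.re → ∀ x, W s x =
      HT s x *
        (partialStandardL T (fun _ => {1}) (2 * s) /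
          (partialStandardL T (fun _ => {1}) (2 * s + 1) *
            partialStandardL T (fun v => {(quadraticHeckeCharCM L).valueAtUniformizer v}) (2 * s + 2))) *
        ∏ v ∈ D, P v s) :
    ∃ Eac : ℂ → X → ℂ, (∀ x, DifferentiableOn ℂ (fun s => Eac s x) {s : ℂ | 0 < s.re}) ∧
      ∀ s : ℂ, 1 < s.re → ∀ x, (s - 1 / 2) * W s x = Eac s x := by
  obtain ⟨G, hG, hsc⟩ := exists_differentiableOn_sub_half_mul_scalarK1_cm L hT
  exact exists_Eac_of_tail_letters W HT _ G D P hHT hP hG hsc htail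

end CM

/-! ## §3 (ED. 2) Tail algebra: `∏'_{v∉T} (c^{K1}_v(s) · P_v(s)) = scalarK1^T(s) · ∏_{v∈D} P_v(s)` when `P_v = 1` off the finite `D`

EDITION 2 (append-only; ED. 1 heads frozen).  Line lead K2E5-p16 (g8) WORD #4 (2) 2026-09-04T22:50:58Z + `hK1a2` BYTES 22:58:28Z (★∕📤 p862811
`K2LiuRankOneSingularLocalValueCM.exists_finset_forall_integral_conjChar_lambdaLoc_weylDelta_eq`: off a finite `T₀` the local factor of ★ G1 `whittakerDelta_eq_mul_tprod_euler`
equals `Val v s 1` BY VALUE) and the by-value letter `hVal : Val v s 1 = c^{K1}_v(s) · Σ_{k ≤ m v} (ε_v q_v^{1−2s})^k` with `m v = 0` off `T ∪ D`.  This section is the TPROD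
ALGEBRA between G1's restricted product and ED. 1's `htail`: the pointwise identity `I v = c^{K1}_v(s) · P v s` with `P v s = 1` for `v ∉ D` (finite, `D ∩ T = ∅`) gives
`∏'_{v∉T} I v = [ζ_F^T(2s) ∕ (ζ_F^T(2s+1)·L^T(2s+2, ε))] · ∏_{v∈D} P v s` (★ FILE 1 `hasProd_localScalarK1` × Mathlib `hasProd_prod_of_ne_finset_one`; the pattern of ★
`K2LiuBigCellTailScalar.tprod_eq_scalar_of_forall_eq` with the extra finitely-supported factor).  §4 then feeds §2: the G1-shaped tail `W s x = HT s x · ∏'_{v∉T} I s v` yields `Eac`.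
ED. 3 (the literal G1 instance `W := whittakerDelta νN S♭ (f ·) ·`, `I s v := ∫ conj ψ_{S♭} · Λ_{s,v}((w_Δ)_v ·)`, `hI := hK1a2 ∘ hVal`) appends here on ★ p862811. -/

section TailGL1

variable {F : Type} [Field F] [NumberField F] {ε : HeckeCharacter F}

/-- **TAIL ALGEBRA (generic number field)**: for `re s > ½`, a finite `D` disjoint from `T`, a factor `P : _ → ℂ` equal to `1` off `D` (among the places off `T`), and a family
`I` over the places off `T` with `I v = c^{K1}_v(s) · P v` pointwise: `∏'_{v∉T} I v = [ζ_F^T(2s) ∕ (ζ_F^T(2s+1)·L^T(2s+2, ε))] · ∏_{v∈D} P v`.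
[cite: Tan1999, §4 Prop. 4.8] [cite: KudlaRallis1994, §2] -/
theorem tprod_eq_scalarK1_mul_finsetProd (hε : ε.IsUnitary) (T : Set (HeightOneSpectrum (𝓞 F))) {s : ℂ} (hs : 1 / 2 < s.re)
    (D : Finset (HeightOneSpectrum (𝓞 F))) (hDT : ∀ v ∈ D, v ∉ T) (P : HeightOneSpectrum (𝓞 F) → ℂ)
    (hP1 : ∀ v, v ∉ T → v ∉ D → P v = 1) (I : {v : HeightOneSpectrum (𝓞 F) // v ∉ T} → ℂ)
    (hI : ∀ v : {v : HeightOneSpectrum (𝓞 F) // v ∉ T},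
      I v = ((1 - (v.1.residueCard : ℂ) ^ (-(2 * s + 1))) * (1 - ε.valueAtUniformizer v.1 * (v.1.residueCard : ℂ) ^ (-(2 * s + 2)))) /
          (1 - (v.1.residueCard : ℂ) ^ (-(2 * s))) * P v.1) :
    ∏' v : {v : HeightOneSpectrum (𝓞 F) // v ∉ T}, I v =
      partialStandardL T (fun _ => {1}) (2 * s) /
          (partialStandardL T (fun _ => {1}) (2 * s + 1) * partialStandardL T (fun v => {ε.valueAtUniformizer v}) (2 * s + 2)) *
        ∏ v ∈ D, P v := by
  classical
  -- the finitely supported factor `v ↦ P v.1` over the places off `T`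
  have hPfin : HasProd (fun v : {v : HeightOneSpectrum (𝓞 F) // v ∉ T} => P v.1)
      (∏ v ∈ D.subtype (fun v => v ∉ T), P (v : HeightOneSpectrum (𝓞 F))) := by
    refine hasProd_prod_of_ne_finset_one fun v hv => hP1 v.1 v.2 ?_
    exact fun hvD => hv (Finset.mem_subtype.2 hvD)
  have hDeq : ∏ v ∈ D.subtype (fun v => v ∉ T), P (v : HeightOneSpectrum (𝓞 F)) = ∏ v ∈ D, P v := by
    rw [Finset.prod_subtype_eq_prod_filter, Finset.filter_true_of_mem hDT]
  rw [hDeq] at hPfin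
  rw [show I = fun v : {v : HeightOneSpectrum (𝓞 F) // v ∉ T} =>
      ((1 - (v.1.residueCard : ℂ) ^ (-(2 * s + 1))) * (1 - ε.valueAtUniformizer v.1 * (v.1.residueCard : ℂ) ^ (-(2 * s + 2)))) /
          (1 - (v.1.residueCard : ℂ) ^ (-(2 * s))) * P v.1 from funext hI]
  exact ((hasProd_localScalarK1 (S := T) hε hs).mul hPfin).tprod_eq

end TailGL1

section TailCM

variable (L : Type) [Field L] [NumberField L] [IsCMField L]

/-- **TAIL ALGEBRA AT THE K2_Liu FRAME** (`ε = ε_{L∕L⁺}`, `F = L⁺`): `∏'_{v∉T} I v = [ζ_{L⁺}^T(2s) ∕ (ζ_{L⁺}^T(2s+1)·L^T(2s+2, ε_{L∕L⁺}))] · ∏_{v∈D} P v` under the pointwise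
identity `I v = c^{K1}_v(s) · P v`, `P = 1` off `D`. [cite: Tan1999, §4 Prop. 4.8] -/
theorem tprod_eq_scalarK1_mul_finsetProd_cm (T : Set (HeightOneSpectrum (𝓞 ↥(maximalRealSubfield L)))) {s : ℂ} (hs : 1 / 2 < s.re)
    (D : Finset (HeightOneSpectrum (𝓞 ↥(maximalRealSubfield L)))) (hDT : ∀ v ∈ D, v ∉ T) (P : HeightOneSpectrum (𝓞 ↥(maximalRealSubfield L)) → ℂ)
    (hP1 : ∀ v, v ∉ T → v ∉ D → P v = 1) (I : {v : HeightOneSpectrum (𝓞 ↥(maximalRealSubfield L)) // v ∉ T} → ℂ)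
    (hI : ∀ v : {v : HeightOneSpectrum (𝓞 ↥(maximalRealSubfield L)) // v ∉ T},
      I v = ((1 - (v.1.residueCard : ℂ) ^ (-(2 * s + 1))) *
            (1 - (quadraticHeckeCharCM L).valueAtUniformizer v.1 * (v.1.residueCard : ℂ) ^ (-(2 * s + 2)))) /
          (1 - (v.1.residueCard : ℂ) ^ (-(2 * s))) * P v.1) :
    ∏' v : {v : HeightOneSpectrum (𝓞 ↥(maximalRealSubfield L)) // v ∉ T}, I v =
      partialStandardL T (fun _ => {1}) (2 * s) /
          (partialStandardL T (fun _ => {1}) (2 * s + 1) *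
            partialStandardL T (fun v => {(quadraticHeckeCharCM L).valueAtUniformizer v}) (2 * s + 2)) *
        ∏ v ∈ D, P v :=
  tprod_eq_scalarK1_mul_finsetProd (Literature.RepresentationTheory.HarrisKudlaSweet1996.isFiniteOrder_quadraticHeckeCharCM (L := L)).isUnitary
    T hs D hDT P hP1 I hI

/-! ## §4 (ED. 2) The G1-shaped head: `W = HT · ∏'_{v∉T} I_v` with `I_v = c^{K1}_v · P_v` pointwise ⟹ `Eac` -/

/-- **(K1a-4) FROM THE RESTRICTED-PRODUCT TAIL** — the shape ★ G1 `whittakerDelta_eq_mul_tprod_euler` delivers.  For a finite `T` of finite places of `L⁺`, a head `HT`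
holomorphic on `Re s > 0` in `s`, a finite `D` disjoint from `T` with factors `P v` holomorphic on `Re s > 0` and `P v s = 1` for `v ∉ T ∪ D`, local factors
`I : ℂ → {v ∉ T} → ℂ` with the POINTWISE identity `I s v = c^{K1}_v(s) · P v s` on `Re s > 1` (= `hK1a2` ∘ `hVal`: ★∕📤 p862811 + the by-value polynomial letter), and the
tail `W s x = HT s x · ∏'_{v∉T} I s v` on `Re s > 1`: there is `Eac`, holomorphic on `Re s > 0` in `s` for every `x`, with `(s − ½)·W s x = Eac s x` on `Re s > 1` (§3 then §2).
[cite: Tan1999, §3; §4 Prop. 4.8] [cite: KudlaRallis1994, §2] -/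
theorem exists_Eac_of_tprod_tail_cm {X : Type*} {T : Set (HeightOneSpectrum (𝓞 ↥(maximalRealSubfield L)))} (hT : T.Finite)
    (W HT : ℂ → X → ℂ) (D : Finset (HeightOneSpectrum (𝓞 ↥(maximalRealSubfield L)))) (hDT : ∀ v ∈ D, v ∉ T)
    (P : HeightOneSpectrum (𝓞 ↥(maximalRealSubfield L)) → ℂ → ℂ)
    (hHT : ∀ x, DifferentiableOn ℂ (fun s => HT s x) {s : ℂ | 0 < s.re})
    (hPd : ∀ v ∈ D, DifferentiableOn ℂ (P v) {s : ℂ | 0 < s.re})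
    (hP1 : ∀ v, v ∉ T → v ∉ D → ∀ s : ℂ, P v s = 1)
    (I : ℂ → {v : HeightOneSpectrum (𝓞 ↥(maximalRealSubfield L)) // v ∉ T} → ℂ)
    (hI : ∀ s : ℂ, 1 < s.re → ∀ v : {v : HeightOneSpectrum (𝓞 ↥(maximalRealSubfield L)) // v ∉ T},
      I s v = ((1 - (v.1.residueCard : ℂ) ^ (-(2 * s + 1))) *
            (1 - (quadraticHeckeCharCM L).valueAtUniformizer v.1 * (v.1.residueCard : ℂ) ^ (-(2 * s + 2)))) /
          (1 - (v.1.residueCard : ℂ) ^ (-(2 * s))) * P v.1 s)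
    (htail : ∀ s : ℂ, 1 < s.re → ∀ x, W s x = HT s x * ∏' v : {v : HeightOneSpectrum (𝓞 ↥(maximalRealSubfield L)) // v ∉ T}, I s v) :
    ∃ Eac : ℂ → X → ℂ, (∀ x, DifferentiableOn ℂ (fun s => Eac s x) {s : ℂ | 0 < s.re}) ∧
      ∀ s : ℂ, 1 < s.re → ∀ x, (s - 1 / 2) * W s x = Eac s x := by
  refine exists_Eac_of_tail_scalarK1_cm L hT W HT D P hHT hPd fun s hs x => ?_
  have hs' : 1 / 2 < s.re := by linarith
  rw [htail s hs x, tprod_eq_scalarK1_mul_finsetProd_cm L T hs' D hDT (fun v => P v s) (fun v hvT hvD => hP1 v hvT hvD s) (I s) (hI s hs),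
    mul_assoc]

end TailCM

end Summit.HodgeConjecture.HodgeConjecture.Cruxes.HLiu418.K2LiuRankOneSingularEulerContinued

end
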